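import Summits.CriticalPhenomena.PercolationContinuityZ3.Theorems.PercNearOneGluingNoHeavyLowerTailSahiT2SquareAtoms
import Mathlib.Tactic.Linarith
import Mathlib.Tactic.Positivity
import Mathlib.Tactic.FieldSimp
import Mathlib.Tactic.Ring
import HarnessLib

/-!
# `NoHeavyLowerTail` (crux stmt-CriticalPhenomena-4575), P2 — THE `(2,2)` ATOM: THE JOINT BERNSTEIN COEFFICIENT `β₁₁ ≥ 0`

Seat `prim-masterthm-p2`, gen 29 (memo `FROM-prim-masterthm-p2-g29-SQUARE-IDENTITY.md` §9; `--supports stmt-CriticalPhenomena-4575`).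
No `sorry`, no named facts, standard axioms.

The corner-`(0,0)` atom `Main − Hpart_00` of the `(2,2)` class is NOT certifiable by a single box identity (memo §9: explicit cells),
but the tensor cubic-Bernstein coefficient that contains it,
`β₁₁ = (Main − Hpart_00) + edgeAtom{0,Z} + edgeAtom{0,C} + pointAtom_0`,
is: square box identity with the gen-29 rule + the one-dimensional box identities on the edges `{0,Z}`, `{0,C}` with the rule
`(0, 1 − F_lo/F_hi)` (`t2edge_hi/both`, `t2edgeR`) + the trivially nonnegative point atom, and the JOINT remainder bound
`t2R00joint_*`.  Main result: `beta11_nonneg`. [this work]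
-/

noncomputable section

open scoped Classical

namespace Summit.CriticalPhenomena.PercolationContinuityZ3.Theorems

namespace SahiT2Square

open Finset Literature.Combinatorics.Sahi2008
open SahiHubTwoLevel (Fm gm rhoOf rhoOf_val sq_core Fm_nonneg Fm_mono_i Fm_sub_nonneg gm_mono_j gm_sub_nonneg)

section Defs

variable {α β : Type} [Fintype α] [Fintype β]
  (wA : α → ℝ) (wB : β → ℝ) (f : Fin 2 → Fin 2 → α → ℝ) (g : Fin 2 → Fin 2 → β → ℝ) (h : Fin 2 → Fin 2 → α → β → ℝ)

/-- Main part of the edge atom on `{lo=(0,0), hi=(x₁,x₂)}` at corner `0`: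
`[2E(g_lo Y_lo) − F_hi E(g_lo H_lo) − G_hi Ȳ_lo] + [2E(g_hi Y_hi) − F_lo E(g_hi H_hi) − G_lo Ȳ_hi]`. -/
def edgeMain (x₁ x₂ : Fin 2) : ℝ :=
  (2 * M2 wA wB f g h 0 0 0 0 - Fm wA f x₁ x₂ * N2 wA wB g h 0 0 - gm wB g x₁ x₂ * Ybar2 wA wB f h 0 0)
  + (2 * M2 wA wB f g h x₁ x₂ x₁ x₂ - Fm wA f 0 0 * N2 wA wB g h x₁ x₂ - gm wB g 0 0 * Ybar2 wA wB f h x₁ x₂)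

/-- The edge atom at corner `0`: `edgeMain − κ_{hi,0}·H̄_0`. -/
def edgeAtom (x₁ x₂ : Fin 2) : ℝ := edgeMain wA wB f g h x₁ x₂ - kap wA wB f g x₁ x₂ 0 0 * Hb2 wA wB h 0 0

/-- The point atom at `0`: `2E(g_0Y_0) − F_0E(g_0H_0) − G_0Ȳ_0`. -/
def pointAtom0 : ℝ := 2 * M2 wA wB f g h 0 0 0 0 - Fm wA f 0 0 * N2 wA wB g h 0 0 - gm wB g 0 0 * Ybar2 wA wB f h 0 0

/-- **`β₁₁`** — the `(1,1)` tensor cubic-Bernstein coefficient of the `(2,2)` expansion (memo §9). -/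
def beta11 : ℝ := (Main wA wB f g h - Hpart00 wA wB f g h) + edgeAtom wA wB f g h 1 0 + edgeAtom wA wB f g h 0 1
  + pointAtom0 wA wB f g h

/-- Edge fibre sum under `σ = (σ_lo, σ_hi)`. -/
def edgeS (x₁ x₂ : Fin 2) (σlo σhi : ℝ) (b : β) : ℝ :=
  g x₁ x₂ b * ((2 - σhi) * Ysl2 wA f h x₁ x₂ b - Fm wA f 0 0 * Hsl2 wA h x₁ x₂ b - (1 - σlo) * Ysl2 wA f h 0 0 b)
  + g 0 0 b * ((2 - σlo) * Ysl2 wA f h 0 0 b - Fm wA f x₁ x₂ * Hsl2 wA h 0 0 b - (1 - σhi) * Ysl2 wA f h x₁ x₂ b)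

/-- Edge covariance part. -/
def edgeCP (x₁ x₂ : Fin 2) (σlo σhi : ℝ) : ℝ :=
  σhi * cov2 wA wB f g h x₁ x₂ x₁ x₂ + (1 - σhi) * cov2 wA wB f g h 0 0 x₁ x₂
  + σlo * cov2 wA wB f g h 0 0 0 0 + (1 - σlo) * cov2 wA wB f g h x₁ x₂ 0 0

/-- Edge linear remainder `σ_hi(G_hi−G_lo)Ȳ_hi + σ_lo(G_lo−G_hi)Ȳ_lo`. -/
def edgeRlin (x₁ x₂ : Fin 2) (σlo σhi : ℝ) : ℝ :=
  σhi * (gm wB g x₁ x₂ - gm wB g 0 0) * Ybar2 wA wB f h x₁ x₂ + σlo * (gm wB g 0 0 - gm wB g x₁ x₂) * Ybar2 wA wB f h 0 0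

end Defs

variable {α β : Type} [Fintype α] [Fintype β]
  {wA : α → ℝ} {wB : β → ℝ} {f : Fin 2 → Fin 2 → α → ℝ} {g : Fin 2 → Fin 2 → β → ℝ} {h : Fin 2 → Fin 2 → α → β → ℝ}

/-- The one-dimensional box identity on an edge (every `σ`). -/
theorem edgeMain_eq (x₁ x₂ : Fin 2) (σlo σhi : ℝ) :
    edgeMain wA wB f g h x₁ x₂ = (∑ b, wB b * edgeS wA f g h x₁ x₂ σlo σhi b) + edgeCP wA wB f g h x₁ x₂ σlo σhi
      + edgeRlin wA wB f g h x₁ x₂ σlo σhi := by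
  have e : ∀ b, wB b * edgeS wA f g h x₁ x₂ σlo σhi b =
      (2 - σhi) * (wB b * (g x₁ x₂ b * Ysl2 wA f h x₁ x₂ b)) - Fm wA f 0 0 * (wB b * (g x₁ x₂ b * Hsl2 wA h x₁ x₂ b))
        - (1 - σlo) * (wB b * (g x₁ x₂ b * Ysl2 wA f h 0 0 b))
      + ((2 - σlo) * (wB b * (g 0 0 b * Ysl2 wA f h 0 0 b)) - Fm wA f x₁ x₂ * (wB b * (g 0 0 b * Hsl2 wA h 0 0 b))
        - (1 - σhi) * (wB b * (g 0 0 b * Ysl2 wA f h x₁ x₂ b))) := fun b => by unfold edgeS; ring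
  have hs : (∑ b, wB b * edgeS wA f g h x₁ x₂ σlo σhi b) =
      (2 - σhi) * M2 wA wB f g h x₁ x₂ x₁ x₂ - Fm wA f 0 0 * N2 wA wB g h x₁ x₂ - (1 - σlo) * M2 wA wB f g h x₁ x₂ 0 0
      + ((2 - σlo) * M2 wA wB f g h 0 0 0 0 - Fm wA f x₁ x₂ * N2 wA wB g h 0 0 - (1 - σhi) * M2 wA wB f g h 0 0 x₁ x₂) := by
    simp only [e, sum_add_distrib, sum_sub_distrib, ← mul_sum]; rfl
  rw [hs]; unfold edgeMain edgeCP cov2 edgeRlin; ring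

/-- The point atom is nonnegative: `E_b[g_0(Y_0 − F_0H_0)] + Cov_b(g_0,Y_0) ≥ 0`. -/
theorem pointAtom0_nonneg [DistribLattice α] [DistribLattice β] (hA : IsFKGMeasure wA) (hB : IsFKGMeasure wB)
    (hf0 : ∀ z₁ z₂ a, 0 ≤ f z₁ z₂ a) (hfa : ∀ z₁ z₂, Monotone (f z₁ z₂))
    (hg0 : ∀ z₁ z₂ b, 0 ≤ g z₁ z₂ b) (hgb : ∀ z₁ z₂, Monotone (g z₁ z₂))
    (hh0 : ∀ z₁ z₂ a b, 0 ≤ h z₁ z₂ a b) (hha : ∀ z₁ z₂ b, Monotone (fun a => h z₁ z₂ a b)) (hhb : ∀ z₁ z₂ a, Monotone (h z₁ z₂ a)) :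
    0 ≤ pointAtom0 wA wB f g h := by
  have hB0 := hB.nonneg
  have c := cov2_nonneg hB hA.nonneg hf0 hg0 hgb hh0 hhb 0 0 0 0
  have s : 0 ≤ ∑ b, wB b * (g 0 0 b * (Ysl2 wA f h 0 0 b - Fm wA f 0 0 * Hsl2 wA h 0 0 b)) :=
    sum_nonneg fun b _ => mul_nonneg (hB0 b) (mul_nonneg (hg0 0 0 b) (sub_nonneg.2 (Fm_mul_Hsl2_le_Ysl2 hA hf0 hfa hh0 hha 0 0 b)))
  have e : pointAtom0 wA wB f g h = (∑ b, wB b * (g 0 0 b * (Ysl2 wA f h 0 0 b - Fm wA f 0 0 * Hsl2 wA h 0 0 b)))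
      + cov2 wA wB f g h 0 0 0 0 := by
    have e1 : ∀ b, wB b * (g 0 0 b * (Ysl2 wA f h 0 0 b - Fm wA f 0 0 * Hsl2 wA h 0 0 b)) =
        wB b * (g 0 0 b * Ysl2 wA f h 0 0 b) - Fm wA f 0 0 * (wB b * (g 0 0 b * Hsl2 wA h 0 0 b)) := fun b => by ring
    simp only [e1, sum_sub_distrib, ← mul_sum]
    unfold pointAtom0 cov2 M2 N2; ring
  rw [e]; exact add_nonneg s c

/-- Edge pieces under the rule `σ = (0, 1 − F_0/F_hi)` (or `σ = 0` when `F_hi = 0`): the edge atom dominates its remainder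
`Re = σ_hi(G_hi−G_0)Ȳ_hi − κ·H̄_0` (fibrewise `S ≥ 0` by `t2edge_hi/both`, `CP ≥ 0`), and `Re ≥ κ(H̄_hi − H̄_0)` (`t2edgeR`). -/
theorem edge_pieces [DistribLattice α] [DistribLattice β] (hA : IsFKGMeasure wA) (hB : IsFKGMeasure wB)
    (hf0 : ∀ z₁ z₂ a, 0 ≤ f z₁ z₂ a) (hfa : ∀ z₁ z₂, Monotone (f z₁ z₂))
    (hg0 : ∀ z₁ z₂ b, 0 ≤ g z₁ z₂ b) (hgb : ∀ z₁ z₂, Monotone (g z₁ z₂))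
    (hh0 : ∀ z₁ z₂ a b, 0 ≤ h z₁ z₂ a b) (hha : ∀ z₁ z₂ b, Monotone (fun a => h z₁ z₂ a b)) (hhb : ∀ z₁ z₂ a, Monotone (h z₁ z₂ a))
    {x₁ x₂ : Fin 2} (hfx : ∀ a, f 0 0 a ≤ f x₁ x₂ a) (hgx : ∀ b, g 0 0 b ≤ g x₁ x₂ b) (hhx : ∀ a b, h 0 0 a b ≤ h x₁ x₂ a b) :
    ∃ Re : ℝ, kap wA wB f g x₁ x₂ 0 0 * (Hb2 wA wB h x₁ x₂ - Hb2 wA wB h 0 0) ≤ Re ∧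
      Re ≤ edgeAtom wA wB f g h x₁ x₂ := by
  have hA0 := hA.nonneg; have hB0 := hB.nonneg
  have f0 : 0 ≤ Fm wA f 0 0 := Fm_nonneg hA0 hf0 0 0
  have flh : Fm wA f 0 0 ≤ Fm wA f x₁ x₂ := sum_le_sum fun a _ => mul_le_mul_of_nonneg_left (hfx a) (hA0 a)
  have glh : gm wB g 0 0 ≤ gm wB g x₁ x₂ := sum_le_sum fun b _ => mul_le_mul_of_nonneg_left (hgx b) (hB0 b)
  have sl := Fm_mul_Hsl2_le_Ysl2 (h := h) hA hf0 hfa hh0 hha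
  have mY : ∀ b, Ysl2 wA f h 0 0 b ≤ Ysl2 wA f h x₁ x₂ b := Ysl2_mono_pt hA0 hf0 hh0 hfx hhx
  have mH : ∀ b, Hsl2 wA h 0 0 b ≤ Hsl2 wA h x₁ x₂ b := Hsl2_mono_pt hA0 hhx
  have c := cov2_nonneg hB hA0 hf0 hg0 hgb hh0 hhb
  by_cases hz : Fm wA f x₁ x₂ = 0
  · -- degenerate edge: F_hi = F_lo = 0, all slices vanish; take σ = 0 and Re = 0
    have h00 : Fm wA f 0 0 = 0 := le_antisymm (by linarith) f0
    have hk : kap wA wB f g x₁ x₂ 0 0 = 0 := by unfold kap; rw [hz, h00]; ring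
    have hY : ∀ b, Ysl2 wA f h x₁ x₂ b = 0 := fun b => Ysl2_eq_zero_of_Fm_eq_zero hA0 hf0 hz b
    have hY0 : ∀ b, Ysl2 wA f h 0 0 b = 0 := fun b => Ysl2_eq_zero_of_Fm_eq_zero hA0 hf0 h00 b
    refine ⟨0, by rw [hk]; simp, ?_⟩
    unfold edgeAtom; rw [hk, edgeMain_eq x₁ x₂ 0 0]
    have hS : ∀ b, edgeS wA f g h x₁ x₂ 0 0 b = 0 := fun b => by unfold edgeS; rw [hY, hY0, hz, h00]; ring
    have hCP : 0 ≤ edgeCP wA wB f g h x₁ x₂ 0 0 := by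
      unfold edgeCP
      have := c x₁ x₂ x₁ x₂; have := c 0 0 x₁ x₂; have := c 0 0 0 0; have := c x₁ x₂ 0 0
      nlinarith
    have hR : edgeRlin wA wB f g h x₁ x₂ 0 0 = 0 := by unfold edgeRlin; ring
    simp only [hS, mul_zero, sum_const_zero, hR]; linarith
  · have hpos : 0 < Fm wA f x₁ x₂ := lt_of_le_of_ne (le_trans f0 flh) (Ne.symm hz)
    set σhi := 1 - Fm wA f 0 0 / Fm wA f x₁ x₂ with hσ
    have s0 : 0 ≤ σhi := by rw [hσ, sub_nonneg, div_le_one hpos]; exact flh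
    have s1 : σhi ≤ 1 := by have := div_nonneg f0 hpos.le; rw [hσ]; linarith
    refine ⟨edgeRlin wA wB f g h x₁ x₂ 0 σhi - kap wA wB f g x₁ x₂ 0 0 * Hb2 wA wB h 0 0, ?_, ?_⟩
    · have key := t2edgeR (Hb0 := Hb2 wA wB h 0 0) hpos flh glh (Fm_mul_Hb2_le_Ybar2 hA hB0 hf0 hfa hh0 hha x₁ x₂)
      have e : edgeRlin wA wB f g h x₁ x₂ 0 σhi - kap wA wB f g x₁ x₂ 0 0 * Hb2 wA wB h 0 0 =
          (1 - Fm wA f 0 0 / Fm wA f x₁ x₂) * (gm wB g x₁ x₂ - gm wB g 0 0) * Ybar2 wA wB f h x₁ x₂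
            - (Fm wA f x₁ x₂ - Fm wA f 0 0) * (gm wB g x₁ x₂ - gm wB g 0 0) * Hb2 wA wB h 0 0 := by
        unfold edgeRlin kap; rw [hσ]; ring
      rw [e]; unfold kap; exact key
    · unfold edgeAtom; rw [edgeMain_eq x₁ x₂ 0 σhi]
      have hS : ∀ b, 0 ≤ edgeS wA f g h x₁ x₂ 0 σhi b := fun b => by
        have Ehi := t2edge_hi (Ylo := Ysl2 wA f h 0 0 b) hpos f0 (sl x₁ x₂ b) (mY b)
        have Eboth := t2edge_both hpos flh (mH b) (sl 0 0 b) (sl x₁ x₂ b)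
        -- layer cake on two points: g_hi ≥ g_lo ≥ 0
        have e : edgeS wA f g h x₁ x₂ 0 σhi b = (g x₁ x₂ b - g 0 0 b) *
            ((2 - (1 - Fm wA f 0 0 / Fm wA f x₁ x₂)) * Ysl2 wA f h x₁ x₂ b - Fm wA f 0 0 * Hsl2 wA h x₁ x₂ b
              - (1 - 0) * Ysl2 wA f h 0 0 b)
            + g 0 0 b * ((2 - (1 - Fm wA f 0 0 / Fm wA f x₁ x₂)) * Ysl2 wA f h x₁ x₂ b - Fm wA f 0 0 * Hsl2 wA h x₁ x₂ b
              - (1 - 0) * Ysl2 wA f h 0 0 b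
              + ((2 - 0) * Ysl2 wA f h 0 0 b - Fm wA f x₁ x₂ * Hsl2 wA h 0 0 b
                - (1 - (1 - Fm wA f 0 0 / Fm wA f x₁ x₂)) * Ysl2 wA f h x₁ x₂ b)) := by
          unfold edgeS; rw [hσ]; ring
        rw [e]
        exact add_nonneg (mul_nonneg (sub_nonneg.2 (hgx b)) Ehi) (mul_nonneg (hg0 0 0 b) Eboth)
      have hSum : 0 ≤ ∑ b, wB b * edgeS wA f g h x₁ x₂ 0 σhi b := sum_nonneg fun b _ => mul_nonneg (hB0 b) (hS b)
      have hCP : 0 ≤ edgeCP wA wB f g h x₁ x₂ 0 σhi := by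
        unfold edgeCP
        have := c x₁ x₂ x₁ x₂; have := c 0 0 x₁ x₂; have := c 0 0 0 0; have := c x₁ x₂ 0 0
        have := mul_nonneg s0 (c x₁ x₂ x₁ x₂); have := mul_nonneg (sub_nonneg.2 s1) (c 0 0 x₁ x₂)
        nlinarith
      linarith

/-- **`β₁₁ ≥ 0`** (the joint corner-`(0,0)` certificate). -/
theorem beta11_nonneg [DistribLattice α] [DistribLattice β] (hA : IsFKGMeasure wA) (hB : IsFKGMeasure wB)
    (hf0 : ∀ z₁ z₂ a, 0 ≤ f z₁ z₂ a) (hf1 : ∀ z₂ a, f 0 z₂ a ≤ f 1 z₂ a) (hf2 : ∀ z₁ a, f z₁ 0 a ≤ f z₁ 1 a)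
    (hfa : ∀ z₁ z₂, Monotone (f z₁ z₂))
    (hg0 : ∀ z₁ z₂ b, 0 ≤ g z₁ z₂ b) (hg1 : ∀ z₂ b, g 0 z₂ b ≤ g 1 z₂ b) (hg2 : ∀ z₁ b, g z₁ 0 b ≤ g z₁ 1 b)
    (hgb : ∀ z₁ z₂, Monotone (g z₁ z₂))
    (hh0 : ∀ z₁ z₂ a b, 0 ≤ h z₁ z₂ a b) (hh1 : ∀ z₂ a b, h 0 z₂ a b ≤ h 1 z₂ a b) (hh2 : ∀ z₁ a b, h z₁ 0 a b ≤ h z₁ 1 a b)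
    (hha : ∀ z₁ z₂ b, Monotone (fun a => h z₁ z₂ a b)) (hhb : ∀ z₁ z₂ a, Monotone (h z₁ z₂ a)) :
    0 ≤ beta11 wA wB f g h := by
  have hA0 := hA.nonneg; have hB0 := hB.nonneg
  -- the edge and point pieces
  obtain ⟨Re1, hRe1, hE1⟩ := edge_pieces (x₁ := 1) (x₂ := 0) hA hB hf0 hfa hg0 hgb hh0 hha hhb
    (fun a => hf1 0 a) (fun b => hg1 0 b) (fun a b => hh1 0 a b)
  obtain ⟨Re2, hRe2, hE2⟩ := edge_pieces (x₁ := 0) (x₂ := 1) hA hB hf0 hfa hg0 hgb hh0 hha hhb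
    (fun a => hf2 0 a) (fun b => hg2 0 b) (fun a b => hh2 0 a b)
  have hP := pointAtom0_nonneg hA hB hf0 hfa hg0 hgb hh0 hha hhb
  -- it suffices to bound the square part jointly with the edge remainders
  suffices key : 0 ≤ Main wA wB f g h - Hpart00 wA wB f g h + Re1 + Re2 by
    unfold beta11; linarith
  -- generic step: from S ≥ 0, CP ≥ 0 and the JOINT remainder bound
  have main_joint : ∀ {ρ : Fin 2 → Fin 2 → ℝ}, (∀ b, 0 ≤ Sbox2 wA f g h ρ b) → 0 ≤ CPart2 wA wB f g h ρ →
      0 ≤ Rlin wA wB f g h ρ - Hpart00 wA wB f g h + Re1 + Re2 →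
      0 ≤ Main wA wB f g h - Hpart00 wA wB f g h + Re1 + Re2 := by
    intro ρ hS hCP hR
    rw [main_eq_square ρ]
    have : 0 ≤ ∑ b, wB b * Sbox2 wA f g h ρ b := sum_nonneg fun b _ => mul_nonneg (hB0 b) (hS b)
    linarith
  -- square order facts: 0=(0,0), Z=(1,0), C=(0,1), T=(1,1)
  have f0 : 0 ≤ Fm wA f 0 0 := Fm_nonneg hA0 hf0 0 0
  have f0Z : Fm wA f 0 0 ≤ Fm wA f 1 0 := Fm_mono_i hA0 hf1 0
  have f0C : Fm wA f 0 0 ≤ Fm wA f 0 1 := by have := Fm_sub_nonneg hA0 hf2 0; linarith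
  have fZT : Fm wA f 1 0 ≤ Fm wA f 1 1 := by have := Fm_sub_nonneg hA0 hf2 1; linarith
  have fCT : Fm wA f 0 1 ≤ Fm wA f 1 1 := Fm_mono_i hA0 hf1 1
  have g0Z : gm wB g 0 0 ≤ gm wB g 1 0 := gm_mono_j hB0 hg1 0
  have g0C : gm wB g 0 0 ≤ gm wB g 0 1 := by have := gm_sub_nonneg hB0 hg2 0; linarith
  have gZT : gm wB g 1 0 ≤ gm wB g 1 1 := by have := gm_sub_nonneg hB0 hg2 1; linarith
  have gCT : gm wB g 0 1 ≤ gm wB g 1 1 := gm_mono_j hB0 hg1 1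
  have hb0Z : Hb2 wA wB h 0 0 ≤ Hb2 wA wB h 1 0 := Hb2_mono_pt hA0 hB0 (fun a b => hh1 0 a b)
  have hb0C : Hb2 wA wB h 0 0 ≤ Hb2 wA wB h 0 1 := Hb2_mono_pt hA0 hB0 (fun a b => hh2 0 a b)
  have hbZT : Hb2 wA wB h 1 0 ≤ Hb2 wA wB h 1 1 := Hb2_mono_pt hA0 hB0 (fun a b => hh2 1 a b)
  have hbCT : Hb2 wA wB h 0 1 ≤ Hb2 wA wB h 1 1 := Hb2_mono_pt hA0 hB0 (fun a b => hh1 1 a b)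
  have yZT : Ybar2 wA wB f h 1 0 ≤ Ybar2 wA wB f h 1 1 := Ybar2_mono_pt hA0 hB0 hf0 hh0 (fun a => hf2 1 a) (fun a b => hh2 1 a b)
  have yCT : Ybar2 wA wB f h 0 1 ≤ Ybar2 wA wB f h 1 1 := Ybar2_mono_pt hA0 hB0 hf0 hh0 (fun a => hf1 1 a) (fun a b => hh1 1 a b)
  have sbT := Fm_mul_Hb2_le_Ybar2 hA hB0 hf0 hfa hh0 hha 1 1
  have sbZ := Fm_mul_Hb2_le_Ybar2 hA hB0 hf0 hfa hh0 hha 1 0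
  have sbC := Fm_mul_Hb2_le_Ybar2 hA hB0 hf0 hfa hh0 hha 0 1
  -- fibre facts
  have sl := Fm_mul_Hsl2_le_Ysl2 (h := h) hA hf0 hfa hh0 hha
  have mZ0 : ∀ b, Ysl2 wA f h 0 0 b ≤ Ysl2 wA f h 1 0 b := Ysl2_mono_pt hA0 hf0 hh0 (fun a => hf1 0 a) (fun a b => hh1 0 a b)
  have mC0 : ∀ b, Ysl2 wA f h 0 0 b ≤ Ysl2 wA f h 0 1 b := Ysl2_mono_pt hA0 hf0 hh0 (fun a => hf2 0 a) (fun a b => hh2 0 a b)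
  have mTZ : ∀ b, Ysl2 wA f h 1 0 b ≤ Ysl2 wA f h 1 1 b := Ysl2_mono_pt hA0 hf0 hh0 (fun a => hf2 1 a) (fun a b => hh2 1 a b)
  have mTC : ∀ b, Ysl2 wA f h 0 1 b ≤ Ysl2 wA f h 1 1 b := Ysl2_mono_pt hA0 hf0 hh0 (fun a => hf1 1 a) (fun a b => hh1 1 a b)
  have hH0 := Hsl2_nonneg hA0 hh0 0 0
  have eZ0 : ∀ b, Hsl2 wA h 0 0 b ≤ Hsl2 wA h 1 0 b := Hsl2_mono_pt hA0 (fun a b => hh1 0 a b)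
  have eC0 : ∀ b, Hsl2 wA h 0 0 b ≤ Hsl2 wA h 0 1 b := Hsl2_mono_pt hA0 (fun a b => hh2 0 a b)
  have eTZ : ∀ b, Hsl2 wA h 1 0 b ≤ Hsl2 wA h 1 1 b := Hsl2_mono_pt hA0 (fun a b => hh2 1 a b)
  have eTC : ∀ b, Hsl2 wA h 0 1 b ≤ Hsl2 wA h 1 1 b := Hsl2_mono_pt hA0 (fun a b => hh1 1 a b)
  have cp : ∀ {ρ : Fin 2 → Fin 2 → ℝ}, (∀ z₁ z₂, 0 ≤ ρ z₁ z₂) → (∀ z₁ z₂, ρ z₁ z₂ ≤ 1) → 0 ≤ CPart2 wA wB f g h ρ :=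
    fun h0 h1 => CPart2_nonneg hB hA0 hf0 hg0 hgb hh0 hhb h0 h1
  -- abbreviations
  set F0 := Fm wA f 0 0 with hF0d; set FZ := Fm wA f 1 0 with hFZd; set FC := Fm wA f 0 1 with hFCd; set FT := Fm wA f 1 1 with hFTd
  -- degenerate case F_T = 0
  by_cases hT : FT = 0
  · have hall : ∀ z₁ z₂, Fm wA f z₁ z₂ = 0 := by
      intro z₁ z₂; fin_cases z₁ <;> fin_cases z₂ <;> simp <;> linarith
    have hY : ∀ z₁ z₂ b, Ysl2 wA f h z₁ z₂ b = 0 := fun z₁ z₂ b => Ysl2_eq_zero_of_Fm_eq_zero hA0 hf0 (hall z₁ z₂) b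
    have hYb : ∀ z₁ z₂, Ybar2 wA wB f h z₁ z₂ = 0 := fun z₁ z₂ => by
      unfold Ybar2; exact sum_eq_zero fun b _ => by rw [hY]; ring
    have hS : ∀ b, 0 ≤ Sbox2 wA f g h (fun _ _ => 0) b := fun b => by simp [Sbox2, hY, hall]
    have hCP := cp (ρ := fun _ _ => 0) (fun _ _ => le_refl _) (fun _ _ => zero_le_one)
    have hk : ∀ z₁ z₂ y₁ y₂, kap wA wB f g z₁ z₂ y₁ y₂ = 0 := fun _ _ _ _ => by unfold kap; rw [hall, hall]; ring
    have hchi : chi wA wB f g = 0 := by unfold chi; rw [hk, hk]; ring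
    have hRl : Rlin wA wB f g h (fun _ _ => 0) = 0 := by unfold Rlin; ring
    refine main_joint hS hCP ?_
    have hH : Hpart00 wA wB f g h = 0 := by unfold Hpart00; rw [hchi, hk, hk]; ring
    have h1 : 0 ≤ Re1 := by have := hRe1; rw [hk] at this; linarith
    have h2 : 0 ≤ Re2 := by have := hRe2; rw [hk] at this; linarith
    rw [hRl, hH]; linarith
  have hTpos : 0 < FT := lt_of_le_of_ne (Fm_nonneg hA0 hf0 1 1) (Ne.symm hT)
  have r11 : 0 ≤ 1 - F0 / FT := by rw [sub_nonneg, div_le_one hTpos]; linarith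
  have r11' : 1 - F0 / FT ≤ 1 := by have := div_nonneg f0 hTpos.le; linarith
  -- common pattern facts
  have pT : ∀ b, 0 ≤ (2 - (1 - F0 / FT)) * Ysl2 wA f h 1 1 b - F0 * Hsl2 wA h 1 1 b - (1 - 0) * Ysl2 wA f h 0 0 b :=
    fun b => t2patT hTpos f0 (sl 1 1 b) (mZ0 b) (mTZ b)
  by_cases hG : gm wB g 0 1 ≤ gm wB g 1 0
  · -- case A : G_C ≤ G_Z
    by_cases hF : FZ ≤ FC
    · -- A1: ρ_C = (F_C − F_Z)/F_T
      let ρ := rhoOf 0 ((FC - FZ) / FT) 0 (1 - F0 / FT)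
      obtain ⟨e00, e01, e10, e11⟩ := rhoOf_val 0 ((FC - FZ) / FT) 0 (1 - F0 / FT)
      have rC : 0 ≤ (FC - FZ) / FT := div_nonneg (sub_nonneg.2 hF) hTpos.le
      have rC' : (FC - FZ) / FT ≤ 1 := by rw [div_le_one hTpos]; linarith
      have hρ0 : ∀ z₁ z₂, 0 ≤ ρ z₁ z₂ := by intro z₁ z₂; fin_cases z₁ <;> fin_cases z₂ <;> first | exact le_refl _ | assumption
      have hρ1 : ∀ z₁ z₂, ρ z₁ z₂ ≤ 1 := by
        intro z₁ z₂; fin_cases z₁ <;> fin_cases z₂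
        · exact zero_le_one
        · exact rC'
        · exact zero_le_one
        · exact r11'
      have hS : ∀ b, 0 ≤ Sbox2 wA f g h ρ b := fun b => by
        unfold Sbox2; simp only [ρ, e00, e01, e10, e11]
        have p2 := t2patZT_A1 hTpos f0 hF (by linarith) (eTZ b) (sl 1 0 b) (sl 1 1 b) (mZ0 b) (mTC b)
        have p3 := t2patCT_A1 hTpos f0 hF fCT (by linarith) (le_trans (hH0 b) (eC0 b)) (sl 0 1 b) (sl 1 1 b) (mC0 b) (mTZ b)
        have p4 := t2patZCT_le (ρZ := (0:ℝ)) (ρC := (FC - FZ) / FT) hTpos f0 hF fCT fZT (hH0 b) (eZ0 b) (eC0 b) (eTZ b)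
          (sl 0 1 b) (sl 1 1 b) (mZ0 b)
        have p5 := t2patAll_le (ρZ := (0:ℝ)) (ρC := (FC - FZ) / FT) (ρT := 1 - F0 / FT) (le_trans f0Z fZT) hF (by linarith)
          (eZ0 b) (eC0 b) (eTZ b) (sl 0 0 b) (sl 1 0 b) (sl 0 1 b) (sl 1 1 b)
        exact sq_core (hg0 0 0 b) (hg1 0 b) (hg2 0 b) (hg2 1 b) (hg1 1 b) (pT b) p2 p3 p4 (by linarith)
      have hCP := cp hρ0 hρ1
      refine main_joint hS hCP ?_
      have key := t2R00joint_A1 (YbC := Ybar2 wA wB f h 0 1) hTpos f0Z hF fCT g0C hG gZT hb0Z hb0C hbZT hbCT yCT sbT hRe1 hRe2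
      rw [R00_eq]; simp only [ρ, e00, e01, e10, e11]
      unfold DT0r DZC_A1 at key; linarith
    · -- A2: ρ_Z = 1 − F_C/F_Z, F_C < F_Z
      have hF' : FC ≤ FZ := le_of_lt (not_le.mp hF)
      have hZpos : 0 < FZ := lt_of_le_of_lt (le_trans f0 f0C) (not_le.mp hF)
      have fC0 : 0 ≤ FC := le_trans f0 f0C
      let ρ := rhoOf 0 0 (1 - FC / FZ) (1 - F0 / FT)
      obtain ⟨e00, e01, e10, e11⟩ := rhoOf_val 0 0 (1 - FC / FZ) (1 - F0 / FT)
      have rZ : 0 ≤ 1 - FC / FZ := by rw [sub_nonneg, div_le_one hZpos]; exact hF'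
      have rZ' : 1 - FC / FZ ≤ 1 := by have := div_nonneg fC0 hZpos.le; linarith
      have hρ0 : ∀ z₁ z₂, 0 ≤ ρ z₁ z₂ := by intro z₁ z₂; fin_cases z₁ <;> fin_cases z₂ <;> first | exact le_refl _ | assumption
      have hρ1 : ∀ z₁ z₂, ρ z₁ z₂ ≤ 1 := by
        intro z₁ z₂; fin_cases z₁ <;> fin_cases z₂
        · exact zero_le_one
        · exact zero_le_one
        · exact rZ'
        · exact r11'
      have hS : ∀ b, 0 ≤ Sbox2 wA f g h ρ b := fun b => by
        unfold Sbox2; simp only [ρ, e00, e01, e10, e11]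
        have p2 := t2patZT_A2 hTpos hZpos f0 fC0 (sl 1 0 b) (sl 1 1 b) (mZ0 b) (mTC b)
        have p3 := t2patCT_A2 hTpos hZpos f0 fC0 hF' fZT (le_trans (le_trans (hH0 b) (eZ0 b)) (eTZ b)) (eTC b)
          (sl 0 1 b) (sl 1 1 b) (mC0 b) (mTZ b)
        have p4 := t2patZCT_ge (ρZ := 1 - FC / FZ) (ρC := (0:ℝ)) hTpos f0 hF' fZT fCT (hH0 b) (eZ0 b) (eC0 b) (eTC b)
          (sl 1 0 b) (sl 1 1 b) (mC0 b)
        have p5 := t2patAll_ge (ρZ := 1 - FC / FZ) (ρC := (0:ℝ)) (ρT := 1 - F0 / FT) (le_trans f0Z fZT) hF' (by linarith)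
          (eZ0 b) (eC0 b) (eTC b) (sl 0 0 b) (sl 1 0 b) (sl 0 1 b) (sl 1 1 b)
        exact sq_core (hg0 0 0 b) (hg1 0 b) (hg2 0 b) (hg2 1 b) (hg1 1 b) (pT b) p2 p3 p4 (by linarith)
      have hCP := cp hρ0 hρ1
      refine main_joint hS hCP ?_
      have key := t2R00joint_A2 (YbZ := Ybar2 wA wB f h 1 0) hTpos hZpos f0Z f0C hF' fZT fCT g0Z g0C hG gZT gCT
        hb0Z hb0C hbZT hbCT sbZ sbT hRe1 hRe2
      rw [R00_eq]; simp only [ρ, e00, e01, e10, e11]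
      unfold DT0r DZC_A2 at key; linarith
  · -- case B : G_Z < G_C
    have hG' : gm wB g 1 0 ≤ gm wB g 0 1 := le_of_lt (not_le.mp hG)
    by_cases hF : FZ < FC
    · -- B1: ρ_C = (F_C − F_Z)/F_C
      have hCpos : 0 < FC := lt_of_le_of_lt (le_trans f0 f0Z) hF
      have fZ0 : 0 ≤ FZ := le_trans f0 f0Z
      let ρ := rhoOf 0 ((FC - FZ) / FC) 0 (1 - F0 / FT)
      obtain ⟨e00, e01, e10, e11⟩ := rhoOf_val 0 ((FC - FZ) / FC) 0 (1 - F0 / FT)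
      have rC : 0 ≤ (FC - FZ) / FC := div_nonneg (sub_nonneg.2 hF.le) hCpos.le
      have rC' : (FC - FZ) / FC ≤ 1 := by rw [div_le_one hCpos]; linarith
      have hρ0 : ∀ z₁ z₂, 0 ≤ ρ z₁ z₂ := by intro z₁ z₂; fin_cases z₁ <;> fin_cases z₂ <;> first | exact le_refl _ | assumption
      have hρ1 : ∀ z₁ z₂, ρ z₁ z₂ ≤ 1 := by
        intro z₁ z₂; fin_cases z₁ <;> fin_cases z₂
        · exact zero_le_one
        · exact rC'
        · exact zero_le_one
        · exact r11'
      have hS : ∀ b, 0 ≤ Sbox2 wA f g h ρ b := fun b => by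
        unfold Sbox2; simp only [ρ, e00, e01, e10, e11]
        have p2 := t2patZT_B1 hTpos hCpos f0 fZ0 hF.le fCT (le_trans (le_trans (hH0 b) (eZ0 b)) (eTZ b)) (eTZ b)
          (sl 1 0 b) (sl 1 1 b) (mZ0 b) (mTC b)
        have p3 := t2patCT_B1 hTpos hCpos f0 fZ0 (sl 0 1 b) (sl 1 1 b) (mC0 b) (mTZ b)
        have p4 := t2patZCT_le (ρZ := (0:ℝ)) (ρC := (FC - FZ) / FC) hTpos f0 hF.le fCT fZT (hH0 b) (eZ0 b) (eC0 b) (eTZ b)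
          (sl 0 1 b) (sl 1 1 b) (mZ0 b)
        have p5 := t2patAll_le (ρZ := (0:ℝ)) (ρC := (FC - FZ) / FC) (ρT := 1 - F0 / FT) (le_trans f0Z fZT) hF.le (by linarith)
          (eZ0 b) (eC0 b) (eTZ b) (sl 0 0 b) (sl 1 0 b) (sl 0 1 b) (sl 1 1 b)
        exact sq_core (hg0 0 0 b) (hg1 0 b) (hg2 0 b) (hg2 1 b) (hg1 1 b) (pT b) p2 p3 p4 (by linarith)
      have hCP := cp hρ0 hρ1
      refine main_joint hS hCP ?_
      have key := t2R00joint_B1 (YbC := Ybar2 wA wB f h 0 1) hTpos hCpos f0Z f0C hF.le fCT fZT g0Z g0C hG' gZT gCT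
        hb0Z hb0C hbZT hbCT sbC sbT hRe1 hRe2
      rw [R00_eq]; simp only [ρ, e00, e01, e10, e11]
      unfold DT0r DZC_B1 at key; linarith
    · -- B2: ρ_Z = (F_Z − F_C)/F_T, F_C ≤ F_Z
      have hF' : FC ≤ FZ := not_lt.mp hF
      let ρ := rhoOf 0 0 ((FZ - FC) / FT) (1 - F0 / FT)
      obtain ⟨e00, e01, e10, e11⟩ := rhoOf_val 0 0 ((FZ - FC) / FT) (1 - F0 / FT)
      have rZ : 0 ≤ (FZ - FC) / FT := div_nonneg (sub_nonneg.2 hF') hTpos.le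
      have rZ' : (FZ - FC) / FT ≤ 1 := by rw [div_le_one hTpos]; linarith [le_trans f0 f0C]
      have hρ0 : ∀ z₁ z₂, 0 ≤ ρ z₁ z₂ := by intro z₁ z₂; fin_cases z₁ <;> fin_cases z₂ <;> first | exact le_refl _ | assumption
      have hρ1 : ∀ z₁ z₂, ρ z₁ z₂ ≤ 1 := by
        intro z₁ z₂; fin_cases z₁ <;> fin_cases z₂
        · exact zero_le_one
        · exact zero_le_one
        · exact rZ'
        · exact r11'
      have hS : ∀ b, 0 ≤ Sbox2 wA f g h ρ b := fun b => by
        unfold Sbox2; simp only [ρ, e00, e01, e10, e11]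
        have p2 : 0 ≤ (2 - (FZ - FC) / FT) * Ysl2 wA f h 1 0 b - FC * Hsl2 wA h 1 0 b - (1 - 0) * Ysl2 wA f h 0 1 b
            + ((2 - (1 - F0 / FT)) * Ysl2 wA f h 1 1 b - F0 * Hsl2 wA h 1 1 b - (1 - 0) * Ysl2 wA f h 0 0 b) := by
          by_cases hZ0 : FZ = 0
          · have hC0 : FC = 0 := le_antisymm (by linarith) (le_trans f0 f0C)
            have h00 : F0 = 0 := le_antisymm (by linarith) f0
            have := t2patZT_B2_zero (YZ := Ysl2 wA f h 1 0 b) (YC := Ysl2 wA f h 0 1 b) (HZ := Hsl2 wA h 1 0 b)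
              (HT := Hsl2 wA h 1 1 b) hTpos (Ysl2_nonneg hA0 hf0 hh0 0 0 b) (mZ0 b) (mTC b)
            rw [hZ0, hC0, h00]; simpa using this
          · have hZpos : 0 < FZ := lt_of_le_of_ne (le_trans f0 f0Z) (Ne.symm hZ0)
            exact t2patZT_B2 hTpos hZpos f0 (le_trans f0 f0C) hF' fZT (le_trans (hH0 b) (eZ0 b)) (sl 1 0 b) (sl 1 1 b) (mZ0 b) (mTC b)
        have p3 := t2patCT_B2 hTpos f0 hF' (by linarith [le_trans f0 f0C]) (eTC b) (sl 0 1 b) (sl 1 1 b) (mC0 b) (mTZ b)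
        have p4 := t2patZCT_ge (ρZ := (FZ - FC) / FT) (ρC := (0:ℝ)) hTpos f0 hF' fZT fCT (hH0 b) (eZ0 b) (eC0 b) (eTC b)
          (sl 1 0 b) (sl 1 1 b) (mC0 b)
        have p5 := t2patAll_ge (ρZ := (FZ - FC) / FT) (ρC := (0:ℝ)) (ρT := 1 - F0 / FT) (le_trans f0Z fZT) hF' (by linarith)
          (eZ0 b) (eC0 b) (eTC b) (sl 0 0 b) (sl 1 0 b) (sl 0 1 b) (sl 1 1 b)
        exact sq_core (hg0 0 0 b) (hg1 0 b) (hg2 0 b) (hg2 1 b) (hg1 1 b) (pT b) p2 p3 p4 (by linarith)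
      have hCP := cp hρ0 hρ1
      refine main_joint hS hCP ?_
      have key := t2R00joint_B2 (YbZ := Ybar2 wA wB f h 1 0) hTpos f0C hF' fZT g0Z hG' gCT hb0Z hb0C hbZT hbCT yZT sbT hRe1 hRe2
      rw [R00_eq]; simp only [ρ, e00, e01, e10, e11]
      unfold DT0r DZC_B2 at key; linarith

end SahiT2Square

end Summit.CriticalPhenomena.PercolationContinuityZ3.Theorems
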